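/-
Copyright (c) 2026 the pub-hodgecm-mathlib formalisation cell (harness21).  Prover seat hodgecm-mathlib-K2E3-p12 (g3), Track B «K2-LIT» ∕ h413
(`stmt-HodgeConjecture-24833`), §L line lead: A LEFT-INVARIANT FINITELY ADDITIVE FUNCTIONAL ON `C_c^∞(G)` IS A MULTIPLE OF HAAR MEASURE (t.d. folklore, the
uniqueness input (a1) of the structure theorem `J(𝒩)(𝔤𝔩₂) = ℂδ₀ ⊕ ℂμ_reg`).  2026-09-04.
-/
import Literature.NumberTheory.Rogawski1990.LocalTransferFundamentalLemma   -- ★ `IsLocSmooth`, `isLocSmooth_indicator`, `isLocSmooth_zero`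
import Literature.Topology.LocallyConstantCompactSupportUniform        -- ★ `exists_nhds_one_forall_mul_eq_of_hasCompactSupport` (uniform local constancy)
import Mathlib.MeasureTheory.Group.Measure
import HarnessLib

/-!
# A left-invariant finitely additive functional on `C_c^∞(G)` is `c · (Haar integral)`

Topic `NumberTheory/Automorphic` (next to ★ `OrbitalIntegralSupportLocalisation`, same currency `IsLocSmooth` = locally constant with compact support);
namespace `Literature.NumberTheory.Automorphic`.  THEOREMS ONLY (no definition ∕ instance ∕ notation ∕ named fact ∕ `sorry`).  Folklore of the harmonic
analysis of totally disconnected groups [BernsteinZelevinsky1976, §1.18–§1.19: a left-invariant distribution on an `l`-group is a left Haar measure;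
CartierCorvallis1979, §1.2 p. 113]: let `G` be a topological group possessing a compact open subgroup `K₀`, `ν` a left Haar measure, and
`T : C_c^∞(G) → ℂ` additive, homogeneous and invariant under left translations `f ↦ f(y ·)`.  Then
`ν(K₀) · T(f) = T(1_{K₀}) · ∫ f dν` for every `f ∈ C_c^∞(G)` — i.e. `T = c · ν` with `c = T(1_{K₀}) ∕ ν(K₀)`.
No continuity of `T` is assumed (on `C_c^∞` of an `l`-space every linear functional is a distribution).

Proof.  (§1) The right stabiliser `{s | ∀ x, f(xs) = f(x)}` of `f ∈ C_c^∞(G)` is an open subgroup (uniform local constancy, ★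
`exists_nhds_one_forall_mul_eq_of_hasCompactSupport`), so `K₁ := K₀ ∩ S` is a compact open subgroup with `f` right-`K₁`-invariant.  (§2) A right-`K₁`-invariant
`f ∈ C_c^∞(G)` is a finite combination `Σ_{q ∈ A} f(q̃) · 1_{q̃K₁}` of indicators of left cosets (`A ⊂ G ∕ K₁` finite: the open cosets cover the compact support);
`T(1_{yK₁}) = T(1_{K₁})` and `ν(yK₁) = ν(K₁)` by left invariance, whence `ν(K₁) T(f) = T(1_{K₁}) ∫ f` (`measureReal_mul_apply_eq_of_forall_mul_eq`).  (§3) The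
same identity for `f := 1_{K₀}` (right-`K₁`-invariant as `K₁ ≤ K₀`) eliminates `K₁`: **`measureReal_mul_apply_eq`**, and the packaged
**`exists_const_forall_apply_eq_mul_integral`** (`∃ c, ∀ f ∈ C_c^∞, T f = c ∫ f dν`).
Consumer (cell `pub/hodgecm-mathlib`, h413 §L): uniqueness of invariant functionals on `C_c^∞(GL₂(F) ∕ Z·N)` ⇒ `J(𝒩)(𝔤𝔩₂(F)) = ℂδ₀ ⊕ ℂμ_reg`
(★ `K2E3GL2NilpotentFourierRegularOfStructure`, hypothesis `hA`).

## References
* [BernsteinZelevinsky1976] I. N. Bernstein, A. V. Zelevinsky, *Representations of the group GL(n, F) where F is a non-archimedean local field*, Russian Math.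
  Surveys 31:3 (1976) 1–68: §1.18–§1.19 (left-invariant distributions on `l`-groups are Haar measures), §1.1–§1.3 (`l`-spaces, `C_c^∞`).
* [CartierCorvallis1979] P. Cartier, *Representations of p-adic groups: a survey*, Proc. Sympos. Pure Math. 33 Part 1 (1979) 111–155: §1.2 p. 113.
-/

set_option autoImplicit false

noncomputable section

open MeasureTheory Measure Topology Set Filter Function
open Literature.NumberTheory.Rogawski1990 Literature.Topology

namespace Literature.NumberTheory.Automorphic

variable {G : Type*} [Group G] [TopologicalSpace G] [IsTopologicalGroup G]

/-! ## §1  The right stabiliser of a test function is an open subgroup -/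

/-- The RIGHT STABILISER `{s | ∀ x, f (x * s) = f x}` of a locally constant compactly supported `f` contains an open subgroup (it IS a subgroup and contains a
neighbourhood of `1` by uniform local constancy). [cite: BernsteinZelevinsky1976, §1.1] -/
theorem exists_open_subgroup_forall_mul_eq {Y : Type*} [Zero Y] {f : G → Y} (hf : IsLocallyConstant f) (hfs : HasCompactSupport f) :
    ∃ S : Subgroup G, IsOpen (S : Set G) ∧ ∀ s ∈ S, ∀ x : G, f (x * s) = f x := by
  obtain ⟨V, hV, hVf⟩ := exists_nhds_one_forall_mul_eq_of_hasCompactSupport hf hfs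
  let S : Subgroup G :=
    { carrier := {s | ∀ x : G, f (x * s) = f x}
      mul_mem' := by
        intro a b ha hb x
        rw [Set.mem_setOf_eq] at ha hb
        rw [← mul_assoc, hb, ha]
      one_mem' := by
        intro x
        rw [mul_one]
      inv_mem' := by
        intro a ha x
        rw [Set.mem_setOf_eq] at ha
        have h := ha (x * a⁻¹)
        rw [inv_mul_cancel_right] at h
        exact h.symm }
  exact ⟨S, Subgroup.isOpen_of_mem_nhds S (Filter.mem_of_superset hV fun v hv x => hVf x v hv), fun s hs x => hs x⟩

/-! ## §2  Right-`K₁`-invariant test functions: `ν(K₁) · T f = T(1_{K₁}) · ∫ f` -/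

section Invariant

omit [TopologicalSpace G] [IsTopologicalGroup G] in
/-- The fibre of `G → G ∕ K₁` over `q` is the left coset `q̃ K₁` (`q̃ = q.out`). [folklore] -/
private theorem preimage_mk_singleton_eq_image (K₁ : Subgroup G) (q : G ⧸ K₁) :
    (QuotientGroup.mk : G → G ⧸ K₁) ⁻¹' {q} = (fun k : G => q.out * k) '' (K₁ : Set G) := by
  ext x
  simp only [Set.mem_preimage, Set.mem_singleton_iff, Set.mem_image, SetLike.mem_coe]
  constructor
  · intro hx
    refine ⟨q.out⁻¹ * x, ?_, by rw [mul_inv_cancel_left]⟩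
    rw [← QuotientGroup.eq, QuotientGroup.out_eq', hx]
  · rintro ⟨k, hk, rfl⟩
    rw [QuotientGroup.mk_mul_of_mem _ hk, QuotientGroup.out_eq']

omit [TopologicalSpace G] [IsTopologicalGroup G] in
/-- `x ∈ q̃ K₁ ↔ q̃⁻¹ x ∈ K₁`. [folklore] -/
private theorem mem_preimage_mk_singleton_iff (K₁ : Subgroup G) (q : G ⧸ K₁) (x : G) :
    x ∈ (QuotientGroup.mk : G → G ⧸ K₁) ⁻¹' {q} ↔ q.out⁻¹ * x ∈ K₁ := by
  rw [preimage_mk_singleton_eq_image]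
  constructor
  · rintro ⟨k, hk, rfl⟩
    rwa [inv_mul_cancel_left]
  · intro h
    exact ⟨_, h, by simp only [mul_inv_cancel_left]⟩

variable [T2Space G] [MeasurableSpace G] [BorelSpace G] (ν : Measure G) [ν.IsHaarMeasure] (T : (G → ℂ) → ℂ)

/-- **Core identity.**  For a compact open subgroup `K₁`, a left Haar measure `ν`, a functional `T` additive and homogeneous on `C_c^∞(G)` and invariant under
left translations, and a RIGHT-`K₁`-INVARIANT `f ∈ C_c^∞(G)`: `ν(K₁) · T f = T(1_{K₁}) · ∫ f dν` (decompose `f = Σ_{q ∈ A} f(q̃) 1_{q̃K₁}` over the finitely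
many cosets meeting the support). [cite: BernsteinZelevinsky1976, §1.18] [cite: CartierCorvallis1979, §1.2 p. 113] -/
theorem measureReal_mul_apply_eq_of_forall_mul_eq
    (hadd : ∀ f g : G → ℂ, IsLocSmooth f → IsLocSmooth g → T (f + g) = T f + T g)
    (hsmul : ∀ (a : ℂ) (f : G → ℂ), IsLocSmooth f → T (a • f) = a * T f)
    (hinv : ∀ (y : G) (f : G → ℂ), IsLocSmooth f → T (fun x => f (y * x)) = T f)
    (K₁ : Subgroup G) (hK₁o : IsOpen (K₁ : Set G)) (hK₁c : IsCompact (K₁ : Set G))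
    {f : G → ℂ} (hf : IsLocSmooth f) (hfK : ∀ x : G, ∀ k ∈ K₁, f (x * k) = f x) :
    (ν.real (K₁ : Set G) : ℂ) * T f = T ((K₁ : Set G).indicator fun _ => (1 : ℂ)) * ∫ x, f x ∂ν := by
  classical
  -- the fibres `S q = q̃ K₁` are compact open, of measure `ν(K₁)`, and `T(1_{S q}) = T(1_{K₁})`
  have hSo : ∀ q : G ⧸ K₁, IsOpen ((QuotientGroup.mk : G → G ⧸ K₁) ⁻¹' {q}) := fun q => by
    rw [preimage_mk_singleton_eq_image]; exact (Homeomorph.mulLeft q.out).isOpenMap _ hK₁o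
  have hSc : ∀ q : G ⧸ K₁, IsCompact ((QuotientGroup.mk : G → G ⧸ K₁) ⁻¹' {q}) := fun q => by
    rw [preimage_mk_singleton_eq_image]; exact hK₁c.image (continuous_const_mul q.out)
  have h1S : ∀ q : G ⧸ K₁, IsLocSmooth (((QuotientGroup.mk : G → G ⧸ K₁) ⁻¹' {q}).indicator fun _ => (1 : ℂ)) := fun q =>
    isLocSmooth_indicator (hSo q) (hSc q).isClosed (hSc q)
  have h1K : IsLocSmooth ((K₁ : Set G).indicator fun _ => (1 : ℂ)) := isLocSmooth_indicator hK₁o hK₁c.isClosed hK₁c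
  have hνS : ∀ q : G ⧸ K₁, ν.real ((QuotientGroup.mk : G → G ⧸ K₁) ⁻¹' {q}) = ν.real (K₁ : Set G) := fun q => by
    rw [measureReal_def, measureReal_def, preimage_mk_singleton_eq_image, Set.image_mul_left, measure_preimage_mul]
  have hTS : ∀ q : G ⧸ K₁, T (((QuotientGroup.mk : G → G ⧸ K₁) ⁻¹' {q}).indicator fun _ => (1 : ℂ)) =
      T ((K₁ : Set G).indicator fun _ => (1 : ℂ)) := fun q => by
    have h : (((QuotientGroup.mk : G → G ⧸ K₁) ⁻¹' {q}).indicator fun _ => (1 : ℂ)) =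
        fun x => (K₁ : Set G).indicator (fun _ => (1 : ℂ)) (q.out⁻¹ * x) := by
      funext x
      by_cases hx : x ∈ (QuotientGroup.mk : G → G ⧸ K₁) ⁻¹' {q}
      · rw [Set.indicator_of_mem hx, Set.indicator_of_mem (show q.out⁻¹ * x ∈ (K₁ : Set G) from (mem_preimage_mk_singleton_iff K₁ q x).1 hx)]
      · rw [Set.indicator_of_notMem hx, Set.indicator_of_notMem (fun h => hx ((mem_preimage_mk_singleton_iff K₁ q x).2 h))]
    rw [h]
    exact hinv q.out⁻¹ _ h1K
  -- finitely many fibres cover the support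
  obtain ⟨A, hA⟩ : ∃ A : Finset (G ⧸ K₁), tsupport f ⊆ ⋃ q ∈ A, (QuotientGroup.mk : G → G ⧸ K₁) ⁻¹' {q} :=
    hf.2.elim_finite_subcover (fun q => (QuotientGroup.mk : G → G ⧸ K₁) ⁻¹' {q}) hSo fun x _ => Set.mem_iUnion.2 ⟨QuotientGroup.mk x, rfl⟩
  -- `f = Σ_{q ∈ A} f(q̃) · 1_{S q}`
  have hdec : f = fun x => ∑ q ∈ A, f q.out * ((QuotientGroup.mk : G → G ⧸ K₁) ⁻¹' {q}).indicator (fun _ => (1 : ℂ)) x := by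
    funext x
    by_cases hx : (QuotientGroup.mk x : G ⧸ K₁) ∈ A
    · rw [Finset.sum_eq_single (QuotientGroup.mk x : G ⧸ K₁)]
      · have hxS : x ∈ (QuotientGroup.mk : G → G ⧸ K₁) ⁻¹' {(QuotientGroup.mk x : G ⧸ K₁)} := rfl
        rw [Set.indicator_of_mem hxS, mul_one]
        have hk := (mem_preimage_mk_singleton_iff K₁ _ x).1 hxS
        have : f x = f ((QuotientGroup.mk x : G ⧸ K₁).out * ((QuotientGroup.mk x : G ⧸ K₁).out⁻¹ * x)) := by rw [mul_inv_cancel_left]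
        rw [this, hfK _ _ hk]
      · intro q _ hq
        rw [Set.indicator_of_notMem, mul_zero]
        intro hxq
        exact hq (Set.mem_singleton_iff.1 (Set.mem_preimage.1 hxq)).symm
      · intro h; exact absurd hx h
    · have hfx : f x = 0 := by
        refine image_eq_zero_of_notMem_tsupport fun hxt => hx ?_
        obtain ⟨q, hq, hxq⟩ := Set.mem_iUnion₂.1 (hA hxt)
        rw [Set.mem_preimage, Set.mem_singleton_iff] at hxq
        rwa [hxq]
      rw [hfx, eq_comm]
      refine Finset.sum_eq_zero fun q hq => ?_
      rw [Set.indicator_of_notMem, mul_zero]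
      intro hxq
      rw [Set.mem_preimage, Set.mem_singleton_iff] at hxq
      exact hx (hxq ▸ hq)
  -- `T` and `∫` of the finite combination
  have hpiece : ∀ q : G ⧸ K₁, IsLocSmooth (fun x => f q.out * ((QuotientGroup.mk : G → G ⧸ K₁) ⁻¹' {q}).indicator (fun _ => (1 : ℂ)) x) := fun q =>
    ⟨(h1S q).1.comp fun y => f q.out * y, (h1S q).2.mul_left⟩
  have hsum : ∀ s : Finset (G ⧸ K₁),
      IsLocSmooth (fun x => ∑ q ∈ s, f q.out * ((QuotientGroup.mk : G → G ⧸ K₁) ⁻¹' {q}).indicator (fun _ => (1 : ℂ)) x) ∧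
      T (fun x => ∑ q ∈ s, f q.out * ((QuotientGroup.mk : G → G ⧸ K₁) ⁻¹' {q}).indicator (fun _ => (1 : ℂ)) x) =
        (∑ q ∈ s, f q.out) * T ((K₁ : Set G).indicator fun _ => (1 : ℂ)) := by
    intro s
    induction s using Finset.induction_on with
    | empty =>
      simp only [Finset.sum_empty, zero_mul]
      refine ⟨isLocSmooth_zero, ?_⟩
      have h := hsmul 0 (fun _ : G => (0 : ℂ)) isLocSmooth_zero
      rw [zero_mul] at h
      have h0 : ((0 : ℂ) • fun _ : G => (0 : ℂ)) = fun _ => 0 := by funext x; simp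
      rwa [h0] at h
    | insert a s ha ih =>
      have heq : (fun x => ∑ q ∈ insert a s, f q.out * ((QuotientGroup.mk : G → G ⧸ K₁) ⁻¹' {q}).indicator (fun _ => (1 : ℂ)) x) =
          (fun x => f a.out * ((QuotientGroup.mk : G → G ⧸ K₁) ⁻¹' {a}).indicator (fun _ => (1 : ℂ)) x) +
            fun x => ∑ q ∈ s, f q.out * ((QuotientGroup.mk : G → G ⧸ K₁) ⁻¹' {q}).indicator (fun _ => (1 : ℂ)) x := by
        funext x; simp only [Finset.sum_insert ha, Pi.add_apply]
      rw [heq]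
      refine ⟨⟨(hpiece a).1.add ih.1.1, (hpiece a).2.add ih.1.2⟩, ?_⟩
      have hsm : (fun x => f a.out * ((QuotientGroup.mk : G → G ⧸ K₁) ⁻¹' {a}).indicator (fun _ => (1 : ℂ)) x) =
          f a.out • ((QuotientGroup.mk : G → G ⧸ K₁) ⁻¹' {a}).indicator fun _ => (1 : ℂ) := by
        funext x; simp only [Pi.smul_apply, smul_eq_mul]
      rw [hadd _ _ (hpiece a) ih.1, ih.2, hsm, hsmul _ _ (h1S a), hTS a, Finset.sum_insert ha, add_mul]
  have hint : ∫ x, f x ∂ν = (∑ q ∈ A, f q.out) * (ν.real (K₁ : Set G) : ℂ) := by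
    conv_lhs => rw [hdec]
    rw [integral_finsetSum _ fun q _ => ((hpiece q).continuous.integrable_of_hasCompactSupport (hpiece q).2), Finset.sum_mul]
    refine Finset.sum_congr rfl fun q _ => ?_
    rw [integral_const_mul, integral_indicator_const _ (hSo q).measurableSet, hνS q, Complex.real_smul, mul_one]
  have hTf : T f = (∑ q ∈ A, f q.out) * T ((K₁ : Set G).indicator fun _ => (1 : ℂ)) := by
    conv_lhs => rw [hdec]
    exact (hsum A).2
  rw [hTf, hint]
  ring

/-! ## §3  Every test function: `ν(K₀) · T f = T(1_{K₀}) · ∫ f` -/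

/-- **A left-invariant finitely additive functional on `C_c^∞(G)` is a multiple of Haar measure**: for a topological group `G` with a compact open subgroup `K₀`,
a left Haar measure `ν`, and `T : (G → ℂ) → ℂ` additive and homogeneous on `C_c^∞(G)` with `T(f(y ·)) = T(f)` for all `y`, one has
`ν(K₀) · T f = T(1_{K₀}) · ∫ f dν` for every `f ∈ C_c^∞(G)`. [cite: BernsteinZelevinsky1976, §1.18] [cite: CartierCorvallis1979, §1.2 p. 113] -/
theorem measureReal_mul_apply_eq
    (hadd : ∀ f g : G → ℂ, IsLocSmooth f → IsLocSmooth g → T (f + g) = T f + T g)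
    (hsmul : ∀ (a : ℂ) (f : G → ℂ), IsLocSmooth f → T (a • f) = a * T f)
    (hinv : ∀ (y : G) (f : G → ℂ), IsLocSmooth f → T (fun x => f (y * x)) = T f)
    (K₀ : Subgroup G) (hK₀o : IsOpen (K₀ : Set G)) (hK₀c : IsCompact (K₀ : Set G))
    {f : G → ℂ} (hf : IsLocSmooth f) :
    (ν.real (K₀ : Set G) : ℂ) * T f = T ((K₀ : Set G).indicator fun _ => (1 : ℂ)) * ∫ x, f x ∂ν := by
  -- a compact open subgroup `K₁ ≤ K₀` with `f` right-`K₁`-invariant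
  obtain ⟨S, hSo, hSf⟩ := exists_open_subgroup_forall_mul_eq hf.1 hf.2
  set K₁ : Subgroup G := K₀ ⊓ S with hK₁
  have hK₁o : IsOpen (K₁ : Set G) := by rw [hK₁, Subgroup.coe_inf]; exact hK₀o.inter hSo
  have hK₁c : IsCompact (K₁ : Set G) := by
    rw [hK₁, Subgroup.coe_inf]; exact hK₀c.inter_right (Subgroup.isClosed_of_isOpen S hSo)
  have hfK : ∀ x : G, ∀ k ∈ K₁, f (x * k) = f x := fun x k hk => hSf k (Subgroup.mem_inf.1 hk).2 x
  -- the core identity for `f` and for `1_{K₀}` (right-`K₁`-invariant since `K₁ ≤ K₀`)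
  have h1 := measureReal_mul_apply_eq_of_forall_mul_eq ν T hadd hsmul hinv K₁ hK₁o hK₁c hf hfK
  have h1K₀ : IsLocSmooth ((K₀ : Set G).indicator fun _ => (1 : ℂ)) := isLocSmooth_indicator hK₀o hK₀c.isClosed hK₀c
  have hK₀K : ∀ x : G, ∀ k ∈ K₁, (K₀ : Set G).indicator (fun _ => (1 : ℂ)) (x * k) = (K₀ : Set G).indicator (fun _ => (1 : ℂ)) x := by
    intro x k hk
    have hk₀ : k ∈ K₀ := (Subgroup.mem_inf.1 hk).1
    by_cases hx : x ∈ (K₀ : Set G)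
    · rw [Set.indicator_of_mem hx, Set.indicator_of_mem (show x * k ∈ (K₀ : Set G) from K₀.mul_mem hx hk₀)]
    · have hxk : x * k ∉ (K₀ : Set G) := fun h => hx (by simpa using K₀.mul_mem h (K₀.inv_mem hk₀))
      rw [Set.indicator_of_notMem hx, Set.indicator_of_notMem hxk]
  have h2 := measureReal_mul_apply_eq_of_forall_mul_eq ν T hadd hsmul hinv K₁ hK₁o hK₁c h1K₀ hK₀K
  rw [integral_indicator_const _ hK₀o.measurableSet, Complex.real_smul, mul_one] at h2
  -- eliminate `K₁` (`ν(K₁) > 0`)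
  have hν₁ : (ν.real (K₁ : Set G) : ℂ) ≠ 0 := by
    rw [Ne, Complex.ofReal_eq_zero]
    exact (ENNReal.toReal_pos (hK₁o.measure_pos ν ⟨1, K₁.one_mem⟩).ne' hK₁c.measure_lt_top.ne).ne'
  have key : (ν.real (K₁ : Set G) : ℂ) * ((ν.real (K₀ : Set G) : ℂ) * T f) =
      (ν.real (K₁ : Set G) : ℂ) * (T ((K₀ : Set G).indicator fun _ => (1 : ℂ)) * ∫ x, f x ∂ν) := by
    calc (ν.real (K₁ : Set G) : ℂ) * ((ν.real (K₀ : Set G) : ℂ) * T f)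
        = (ν.real (K₀ : Set G) : ℂ) * ((ν.real (K₁ : Set G) : ℂ) * T f) := by ring
      _ = (ν.real (K₀ : Set G) : ℂ) * (T ((K₁ : Set G).indicator fun _ => (1 : ℂ)) * ∫ x, f x ∂ν) := by rw [h1]
      _ = ((ν.real (K₁ : Set G) : ℂ) * T ((K₀ : Set G).indicator fun _ => (1 : ℂ))) * ∫ x, f x ∂ν := by rw [h2]; ring
      _ = (ν.real (K₁ : Set G) : ℂ) * (T ((K₀ : Set G).indicator fun _ => (1 : ℂ)) * ∫ x, f x ∂ν) := by ring
  exact mul_left_cancel₀ hν₁ key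

/-- Packaged form: **`T = c · ν` on `C_c^∞(G)`** with `c = T(1_{K₀}) ∕ ν(K₀)` for any compact open subgroup `K₀`.
[cite: BernsteinZelevinsky1976, §1.18] [cite: CartierCorvallis1979, §1.2 p. 113] -/
theorem exists_const_forall_apply_eq_mul_integral
    (hadd : ∀ f g : G → ℂ, IsLocSmooth f → IsLocSmooth g → T (f + g) = T f + T g)
    (hsmul : ∀ (a : ℂ) (f : G → ℂ), IsLocSmooth f → T (a • f) = a * T f)
    (hinv : ∀ (y : G) (f : G → ℂ), IsLocSmooth f → T (fun x => f (y * x)) = T f)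
    (K₀ : Subgroup G) (hK₀o : IsOpen (K₀ : Set G)) (hK₀c : IsCompact (K₀ : Set G)) :
    ∃ c : ℂ, ∀ f : G → ℂ, IsLocSmooth f → T f = c * ∫ x, f x ∂ν := by
  have hν₀ : (ν.real (K₀ : Set G) : ℂ) ≠ 0 := by
    rw [Ne, Complex.ofReal_eq_zero]
    exact (ENNReal.toReal_pos (hK₀o.measure_pos ν ⟨1, K₀.one_mem⟩).ne' hK₀c.measure_lt_top.ne).ne'
  refine ⟨T ((K₀ : Set G).indicator fun _ => (1 : ℂ)) / (ν.real (K₀ : Set G) : ℂ), fun f hf => ?_⟩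
  have h := measureReal_mul_apply_eq ν T hadd hsmul hinv K₀ hK₀o hK₀c hf
  rw [div_mul_eq_mul_div, eq_div_iff hν₀]
  linear_combination h

end Invariant

end Literature.NumberTheory.Automorphic
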